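import Summits.QuantumFields.YangMills.Theses.ComplexCouplingChannel

/-!
# Crux-ideate sketch (ideator 1, round 1) — `TubeZeroFreeChannel` (stmt-QuantumFields-18841)

First lemmas of the two idea cards, typed over existing declarations (the strategist's named
definitions `Zc`, `UniformZeroFreeOn`, `SealedWall`, `WeakCouplingCorridor` and their proved
glues `not_tubeZeroFreeChannel_of_sealedWall`, `tubeZeroFreeChannel_of_split`).

* Card `legendre-capped-pocket`: `TwoBranchAccumulation` (BKW-type accumulation of tube zeros at an
  equimodular point of two dominant holomorphic branches — pure complex analysis, stated),
  `AccumulatesTubeZeros`, `CappedPocket` and the PROVED glue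
  `not_tubeZeroFreeChannel_of_cappedPocket : CappedPocket G r → ¬ TubeZeroFreeChannel`
  (a capped pocket — left wall up to the triple point + vacuum/torelon equimodularity cap — is a
  sealed wall; no global wall graph needed).
* Card `af-transport-constant-width`: the target shape `ConstantWidthStrip` (one half-width `δ`
  serves every weak coupling), its compact-range little brother `CompactRangeStrip`, and the
  PROVED glue `weakCouplingCorridor_of_constantWidthStrip : ConstantWidthStrip → WeakCouplingCorridor`
  (so AF transport + a compact-range bridge feed the crux through `tubeZeroFreeChannel_of_split`).
-/

set_option autoImplicit false

noncomputable section

namespace Summit.QuantumFields.YangMills.Cruxes.TubeZeroFreeChannel.Ideator1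

open scoped BigOperators Topology
open MeasureTheory Filter
open Literature.MathematicalPhysics.QuantumFieldTheory (LatticeRep IsCompactSimpleLieGroup
  haarProbability)
open Summit.QuantumFields.YangMills.Theses.ComplexCouplingChannel (TubeZeroFreeChannel)

/-! ## Strategist material — copied VERBATIM from `Cruxes/TubeZeroFreeChannel/StrategistSketch.lean`
(planner-cstrat-stmt-QuantumFields-18841-b1-0, rc 0, 0 sorries; that module is not built on the farm,
so it cannot be imported here). -/

section Defs

variable (G : Type) [Group G] [TopologicalSpace G] [IsTopologicalGroup G] [CompactSpace G]
  [MeasurableSpace G] [BorelSpace G]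

/-- The complex-coupling Wilson partition function of the periodic box `a³ × t` in the
representation `r` — verbatim the `let Zc` of the route decl `TubeZeroFreeChannel`. -/
def Zc (r : LatticeRep G) (z : ℂ) (a t : ℕ) : ℂ :=
  let St := Fin a × Fin a × Fin a × Fin t
  let sh : St → Fin 4 → St := fun x μ => ![(finRotate a x.1, x.2.1, x.2.2.1, x.2.2.2),
    (x.1, finRotate a x.2.1, x.2.2.1, x.2.2.2), (x.1, x.2.1, finRotate a x.2.2.1, x.2.2.2),
    (x.1, x.2.1, x.2.2.1, finRotate t x.2.2.2)] μ
  let pl : (St × Fin 4 → G) → St → Fin 4 → Fin 4 → G := fun U x μ ν =>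
    U (x, μ) * U (sh x μ, ν) * (U (sh x ν, μ))⁻¹ * (U (x, ν))⁻¹
  ∫ U, Complex.exp (-(z * ((∑ x : St, ∑ q : {q : Fin 4 × Fin 4 // q.1 < q.2},
    ((r.N : ℝ) - (r.ρ (pl U x q.1.1 q.1.2)).trace.re) : ℝ) : ℂ)))
    ∂(Measure.pi fun _ : St × Fin 4 => haarProbability G)

/-- Uniform tube zero-freeness on `D`: a cross-section floor `L₀` and, for each `L ≥ L₀`, a length
floor `t₀(L)` beyond which no tube partition function vanishes anywhere on `D`. -/
def UniformZeroFreeOn (r : LatticeRep G) (D : Set ℂ) : Prop :=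
  ∃ L₀ : ℕ, ∀ L : ℕ, L₀ ≤ L → ∃ t₀ : ℕ, ∀ t : ℕ, t₀ ≤ t → ∀ z ∈ D, Zc G r z L t ≠ 0

/-- `D` is an anchor-connected uniformly zero-free channel to `β` at tolerance `ρ`. -/
def IsChannel (r : LatticeRep G) (β ρ : ℝ) (D : Set ℂ) : Prop :=
  IsOpen D ∧ IsConnected D ∧ (β : ℂ) ∈ D ∧ (∃ x : ℝ, |x| < ρ ∧ (x : ℂ) ∈ D) ∧
    UniformZeroFreeOn G r D

/-- NEGATION — the typed obstruction.  A SEALED WALL for `(G, r)`: an open region `R ⊂ ℂ` that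
contains every large real coupling, whose closure misses every small real coupling, and every
frontier point of which is a cofinal (in `L`, then in `t`) accumulation point of tube zeros. -/
def SealedWall (r : LatticeRep G) : Prop :=
  ∃ R : Set ℂ, IsOpen R ∧ (∃ b : ℝ, ∀ β : ℝ, b ≤ β → (β : ℂ) ∈ R) ∧
    (∃ ρ : ℝ, 0 < ρ ∧ ∀ x : ℝ, |x| < ρ → (x : ℂ) ∉ closure R) ∧
    ∀ w ∈ frontier R, ∀ ε : ℝ, 0 < ε → ∀ L₀ : ℕ, ∃ L : ℕ, L₀ ≤ L ∧
      ∀ t₀ : ℕ, ∃ t : ℕ, t₀ ≤ t ∧ ∃ z : ℂ, dist z w < ε ∧ Zc G r z L t = 0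

variable {G}

/-- Uniform zero-freeness is stable under binary unions (max of the floors). -/
theorem uniformZeroFreeOn_union (r : LatticeRep G) {D₁ D₂ : Set ℂ}
    (h₁ : UniformZeroFreeOn G r D₁) (h₂ : UniformZeroFreeOn G r D₂) :
    UniformZeroFreeOn G r (D₁ ∪ D₂) := by
  obtain ⟨L₁, hL₁⟩ := h₁
  obtain ⟨L₂, hL₂⟩ := h₂
  refine ⟨max L₁ L₂, fun L hL => ?_⟩
  obtain ⟨t₁, ht₁⟩ := hL₁ L (le_of_max_le_left hL)
  obtain ⟨t₂, ht₂⟩ := hL₂ L (le_of_max_le_right hL)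
  refine ⟨max t₁ t₂, fun t ht z hz => ?_⟩
  rcases hz with hz | hz
  · exact ht₁ t (le_of_max_le_left ht) z hz
  · exact ht₂ t (le_of_max_le_right ht) z hz

/-- Uniform zero-freeness passes to subsets. -/
theorem uniformZeroFreeOn_mono (r : LatticeRep G) {D₁ D₂ : Set ℂ} (h : D₁ ⊆ D₂)
    (h₂ : UniformZeroFreeOn G r D₂) : UniformZeroFreeOn G r D₁ := by
  obtain ⟨L₀, hL₀⟩ := h₂
  refine ⟨L₀, fun L hL => ?_⟩
  obtain ⟨t₀, ht₀⟩ := hL₀ L hL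
  exact ⟨t₀, fun t ht z hz => ht₀ t ht z (h hz)⟩

end Defs

/-- The crux over the named definitions. -/
def CruxBody : Prop :=
  ∀ (G : Type) [Group G] [TopologicalSpace G] [IsTopologicalGroup G] [CompactSpace G]
    [MeasurableSpace G] [BorelSpace G], IsCompactSimpleLieGroup G → ∀ r : LatticeRep G,
    ∃ β₁ : ℝ, ∀ β : ℝ, β₁ ≤ β → ∀ ρ : ℝ, 0 < ρ → ∃ D : Set ℂ, IsChannel G r β ρ D

/-- The route decl IS `CruxBody`, definitionally. -/
theorem tubeZeroFreeChannel_iff : TubeZeroFreeChannel ↔ CruxBody := Iff.rfl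

/-! ## DECOMPOSITION — bridge ⊕ corridor (glue proved; NOT filed, see STRATEGY-CENSUS.md) -/

/-- Sub₁ `CrossoverBridge`: the anchor-connected uniformly zero-free region reaches arbitrarily
large real couplings at SOME points (false for `U(1)`; finite coupling range; carries the
non-abelian content and the complex detours around on-axis first-order walls). -/
def CrossoverBridge : Prop :=
  ∀ (G : Type) [Group G] [TopologicalSpace G] [IsTopologicalGroup G] [CompactSpace G]
    [MeasurableSpace G] [BorelSpace G], IsCompactSimpleLieGroup G → ∀ r : LatticeRep G,
    ∀ b : ℝ, ∀ ρ : ℝ, 0 < ρ → ∃ β : ℝ, b ≤ β ∧ ∃ D : Set ℂ, IsChannel G r β ρ D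

/-- Sub₂ `WeakCouplingCorridor`: beyond some `β_c(G, r)` any two real couplings are joined by an
open connected uniformly zero-free set (no wall meets the weak-coupling axis; the asymptotic-freedom
piece, `U(1)`-true in kind). -/
def WeakCouplingCorridor : Prop :=
  ∀ (G : Type) [Group G] [TopologicalSpace G] [IsTopologicalGroup G] [CompactSpace G]
    [MeasurableSpace G] [BorelSpace G], IsCompactSimpleLieGroup G → ∀ r : LatticeRep G,
    ∃ βc : ℝ, ∀ b β : ℝ, βc ≤ b → βc ≤ β → ∃ D : Set ℂ, IsOpen D ∧ IsConnected D ∧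
      (b : ℂ) ∈ D ∧ (β : ℂ) ∈ D ∧ UniformZeroFreeOn G r D

/-- The split glue (sorry-free): bridge to some `b ≥ β_c`, then the corridor from `b` to `β`; the
union of two open connected uniformly zero-free sets through the common real point `b` is a
channel. -/
theorem tubeZeroFreeChannel_of_split :
    CrossoverBridge → WeakCouplingCorridor → TubeZeroFreeChannel := by
  intro hB hC
  rw [tubeZeroFreeChannel_iff]
  intro G _ _ _ _ _ _ hG r
  obtain ⟨βc, hc⟩ := hC G hG r
  refine ⟨βc, fun β hβ ρ hρ => ?_⟩
  obtain ⟨b, hb, D₁, ho₁, hc₁, hb₁, ⟨x, hx, hxD⟩, hz₁⟩ := hB G hG r βc ρ hρ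
  obtain ⟨D₂, ho₂, hc₂, hb₂, hβ₂, hz₂⟩ := hc b β hb hβ
  exact ⟨D₁ ∪ D₂, ho₁.union ho₂, IsConnected.union ⟨(b : ℂ), hb₁, hb₂⟩ hc₁ hc₂, Or.inr hβ₂,
    ⟨x, hx, Or.inl hxD⟩, uniformZeroFreeOn_union r hz₁ hz₂⟩

/-! ## NEGATION — a sealed wall refutes the crux (glue proved) -/

/-- If some admissible `(G, r)` has a sealed wall, the crux is false: any open connected `D`
containing a large real `β ∈ R` and a small real `x ∉ closure R` meets `frontier R`
(`IsPreconnected.subset_of_closure_inter_subset`), hence contains a small ball around an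
accumulation point of tube zeros. -/
theorem not_tubeZeroFreeChannel_of_sealedWall (G : Type) [Group G] [TopologicalSpace G]
    [IsTopologicalGroup G] [CompactSpace G] [MeasurableSpace G] [BorelSpace G]
    (hG : IsCompactSimpleLieGroup G) (r : LatticeRep G) (h : SealedWall G r) :
    ¬ TubeZeroFreeChannel := by
  intro hT
  rw [tubeZeroFreeChannel_iff] at hT
  obtain ⟨R, hRo, ⟨b, hb⟩, ⟨ρ, hρ, hx⟩, hW⟩ := h
  obtain ⟨β₁, hβ₁⟩ := hT G hG r
  obtain ⟨D, hDo, hDc, hβD, ⟨x, hxρ, hxD⟩, L₀, hL⟩ := hβ₁ (max β₁ b) (le_max_left _ _) ρ hρ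
  have hβR : ((max β₁ b : ℝ) : ℂ) ∈ R := hb _ (le_max_right _ _)
  have hnot : ¬ (closure R ∩ D ⊆ R) := fun hsub =>
    hx x hxρ (subset_closure
      (hDc.isPreconnected.subset_of_closure_inter_subset hRo ⟨_, hβD, hβR⟩ hsub hxD))
  obtain ⟨w, ⟨hwc, hwD⟩, hwR⟩ := Set.not_subset.mp hnot
  have hwf : w ∈ frontier R := ⟨hwc, by rwa [hRo.interior_eq]⟩
  obtain ⟨ε, hε, hball⟩ := Metric.isOpen_iff.mp hDo w hwD
  obtain ⟨L, hL₀L, hLt⟩ := hW w hwf ε hε L₀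
  obtain ⟨t₀, ht₀⟩ := hL L hL₀L
  obtain ⟨t, ht₀t, z, hz, hZ⟩ := hLt t₀
  exact ht₀ t ht₀t z (hball (Metric.mem_ball.mpr hz)) hZ

/-! ## Card `legendre-capped-pocket` -/

/-- FIRST LEMMA (pure complex analysis, BKW-type, provable; stated): if two holomorphic branches
`l₀, l₁` are equimodular at `z₀`, their ratio is non-constant, and the coefficients `a, b` do not
vanish at `z₀`, then for every `ε > 0` and ALL large `t` the function
`a·l₀^t + b·l₁^t + R_t` (with a remainder exponentially subdominant to `l₀^t`) has a zero in
`B(z₀, ε)`.  This is the mechanism by which tube zeros accumulate, for each fixed cross-section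
`L`, on the equimodularity curves of the two top eigenvalue branches of the transfer operator
`T_L(z)` (vacuum vs. disordered branch = left wall; vacuum vs. torelon/glueball branch = cap). -/
def TwoBranchAccumulation : Prop :=
  ∀ (l₀ l₁ a b : ℂ → ℂ) (z₀ : ℂ) (ρ θ C : ℝ), 0 < ρ → 0 ≤ θ → θ < 1 → 0 ≤ C →
    DifferentiableOn ℂ l₀ (Metric.ball z₀ ρ) → DifferentiableOn ℂ l₁ (Metric.ball z₀ ρ) →
    DifferentiableOn ℂ a (Metric.ball z₀ ρ) → DifferentiableOn ℂ b (Metric.ball z₀ ρ) →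
    (∀ z ∈ Metric.ball z₀ ρ, l₀ z ≠ 0) → ‖l₁ z₀‖ = ‖l₀ z₀‖ → a z₀ ≠ 0 → b z₀ ≠ 0 →
    (¬ ∃ c : ℂ, ∀ z ∈ Metric.ball z₀ ρ, l₁ z = c * l₀ z) →
    ∀ R : ℕ → ℂ → ℂ, (∀ t : ℕ, DifferentiableOn ℂ (R t) (Metric.ball z₀ ρ)) →
      (∀ (t : ℕ) (z : ℂ), z ∈ Metric.ball z₀ ρ → ‖R t z‖ ≤ C * θ ^ t * ‖l₀ z‖ ^ t) →
      ∀ ε : ℝ, 0 < ε → ∃ t₀ : ℕ, ∀ t : ℕ, t₀ ≤ t →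
        ∃ z ∈ Metric.ball z₀ ε, a z * l₀ z ^ t + b z * l₁ z ^ t + R t z = 0

section Pocket

variable (G : Type) [Group G] [TopologicalSpace G] [IsTopologicalGroup G] [CompactSpace G]
  [MeasurableSpace G] [BorelSpace G]

/-- `w` is a cofinal (in `L`, then in `t`) accumulation point of tube zeros of `(G, r)` — the
frontier clause of the strategist's `SealedWall`. -/
def AccumulatesTubeZeros (r : LatticeRep G) (w : ℂ) : Prop :=
  ∀ ε : ℝ, 0 < ε → ∀ L₀ : ℕ, ∃ L : ℕ, L₀ ≤ L ∧ ∀ t₀ : ℕ, ∃ t : ℕ, t₀ ≤ t ∧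
    ∃ z : ℂ, dist z w < ε ∧ Zc G r z L t = 0

/-- CAPPED POCKET for `(G, r)`: the weak-coupling vacuum-dominated pocket
`P = {z : x₁ < Re z, |Im z| < h(Re z)}` (left side = the first-order coexistence wall rising from
the real transition point `x₁ = z_t`, roof/floor = the equimodularity cap `y = ± h(x)` of the
vacuum with the lightest winding/glueball branch, `h ≈ 11 N²/(48π)` in effective Wilson units)
has its WHOLE frontier made of accumulation points of tube zeros.  Only the wall segment below
the cap and the cap itself enter — no global wall graph. -/
def CappedPocket (r : LatticeRep G) : Prop :=
  ∃ x₁ : ℝ, 0 < x₁ ∧ ∃ h : ℝ → ℝ, Continuous h ∧ (∀ x, 0 < h x) ∧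
    ∀ w ∈ frontier {z : ℂ | x₁ < z.re ∧ |z.im| < h z.re}, AccumulatesTubeZeros G r w

/-- A capped pocket is a sealed wall (sorry-free). -/
theorem sealedWall_of_cappedPocket (r : LatticeRep G) (hP : CappedPocket G r) :
    SealedWall G r := by
  obtain ⟨x₁, hx₁, h, hc, hpos, hfr⟩ := hP
  refine ⟨{z : ℂ | x₁ < z.re ∧ |z.im| < h z.re}, ?_, ⟨x₁ + 1, ?_⟩, ⟨x₁, hx₁, ?_⟩, ?_⟩
  · exact (isOpen_lt continuous_const Complex.continuous_re).inter
      (isOpen_lt (continuous_abs.comp Complex.continuous_im) (hc.comp Complex.continuous_re))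
  · intro β hβ
    refine ⟨?_, ?_⟩
    · simp only [Complex.ofReal_re]
      linarith
    · simp only [Complex.ofReal_im, Complex.ofReal_re, abs_zero]
      exact hpos β
  · intro x hx hxcl
    have hsub : closure {z : ℂ | x₁ < z.re ∧ |z.im| < h z.re} ⊆ {z : ℂ | x₁ ≤ z.re} :=
      closure_minimal (fun z hz => le_of_lt hz.1) (isClosed_le continuous_const Complex.continuous_re)
    have hx' : x₁ ≤ (x : ℂ).re := hsub hxcl
    simp only [Complex.ofReal_re] at hx'
    linarith [(abs_lt.mp hx).2]
  · intro w hw ε hε L₀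
    exact hfr w hw ε hε L₀

/-- Card `legendre-capped-pocket`, landing glue (sorry-free): a capped pocket at ONE admissible
`(G, r)` refutes the crux as typed. -/
theorem not_tubeZeroFreeChannel_of_cappedPocket (hG : IsCompactSimpleLieGroup G)
    (r : LatticeRep G) (hP : CappedPocket G r) : ¬ TubeZeroFreeChannel :=
  not_tubeZeroFreeChannel_of_sealedWall G hG r (sealedWall_of_cappedPocket G r hP)

end Pocket

/-! ## Card `af-transport-constant-width` -/

/-- The `δ`-box around the real segment `[b, β]`. -/
def box (b β δ : ℝ) : Set ℂ := {z : ℂ | b - δ < z.re ∧ z.re < β + δ ∧ -δ < z.im ∧ z.im < δ}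

theorem isOpen_box (b β δ : ℝ) : IsOpen (box b β δ) :=
  (isOpen_lt continuous_const Complex.continuous_re).inter
    ((isOpen_lt Complex.continuous_re continuous_const).inter
      ((isOpen_lt continuous_const Complex.continuous_im).inter
        (isOpen_lt Complex.continuous_im continuous_const)))

theorem convex_box (b β δ : ℝ) : Convex ℝ (box b β δ) :=
  (convex_halfSpace_re_gt (b - δ)).inter ((convex_halfSpace_re_lt (β + δ)).inter
    ((convex_halfSpace_im_gt (-δ)).inter (convex_halfSpace_im_lt δ)))

theorem ofReal_mem_box {b β δ x : ℝ} (hδ : 0 < δ) (hbx : b ≤ x) (hxβ : x ≤ β) :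
    (x : ℂ) ∈ box b β δ := by
  refine ⟨?_, ?_, ?_, ?_⟩ <;>
    simp only [Complex.ofReal_re, Complex.ofReal_im] <;> linarith

/-- TARGET SHAPE C⁺ of the AF-transport line (stronger than `WeakCouplingCorridor`, it fixes the
channel to an axis-hugging box of ONE half-width): beyond `β_c(G, r)` a single `δ > 0` serves
every pair of weak couplings — "the corridor does not narrow as `β → ∞`" (asymptotic freedom does
not run `Im z`; 't Hooft's horn in `g²` is a strip in `z = const/g²`). -/
def ConstantWidthStrip : Prop :=
  ∀ (G : Type) [Group G] [TopologicalSpace G] [IsTopologicalGroup G] [CompactSpace G]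
    [MeasurableSpace G] [BorelSpace G], IsCompactSimpleLieGroup G → ∀ r : LatticeRep G,
    ∃ βc : ℝ, ∃ δ : ℝ, 0 < δ ∧ ∀ b β : ℝ, βc ≤ b → b ≤ β → UniformZeroFreeOn G r (box b β δ)

/-- Its compact-range little brother (what must be supplied at bounded coupling, for Wilson's
action; the transported version for Bałaban effective actions is not a tree object): for EVERY
finite window `[β_c, β⋆]` some half-width works. The AF-transport stub of the card is exactly
`CompactRangeStrip (at one large β⋆) + complex-sector UV stability ⇒ ConstantWidthStrip`. -/
def CompactRangeStrip : Prop :=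
  ∀ (G : Type) [Group G] [TopologicalSpace G] [IsTopologicalGroup G] [CompactSpace G]
    [MeasurableSpace G] [BorelSpace G], IsCompactSimpleLieGroup G → ∀ r : LatticeRep G,
    ∃ βc : ℝ, ∀ βstar : ℝ, ∃ δ : ℝ, 0 < δ ∧
      ∀ b β : ℝ, βc ≤ b → b ≤ β → β ≤ βstar → UniformZeroFreeOn G r (box b β δ)

/-- Trivially the constant-width strip gives every compact-range strip. -/
theorem compactRangeStrip_of_constantWidthStrip (h : ConstantWidthStrip) : CompactRangeStrip := by
  intro G _ _ _ _ _ _ hG r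
  obtain ⟨βc, δ, hδ, hz⟩ := h G hG r
  exact ⟨βc, fun _ => ⟨δ, hδ, fun b β hb hbβ _ => hz b β hb hbβ⟩⟩

/-- Card glue (sorry-free): the constant-width strip is a weak-coupling corridor (the box about
`[min b β, max b β]` is open, convex, contains both points, uniformly zero-free). Composes with the
strategist's `tubeZeroFreeChannel_of_split : CrossoverBridge → WeakCouplingCorridor → crux`. -/
theorem weakCouplingCorridor_of_constantWidthStrip (h : ConstantWidthStrip) :
    WeakCouplingCorridor := by
  intro G _ _ _ _ _ _ hG r
  obtain ⟨βc, δ, hδ, hz⟩ := h G hG r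
  refine ⟨βc, fun b β hb hβ => ⟨box (min b β) (max b β) δ, isOpen_box _ _ _,
    (convex_box _ _ _).isConnected ⟨(b : ℂ), ofReal_mem_box hδ (min_le_left _ _) (le_max_left _ _)⟩,
    ofReal_mem_box hδ (min_le_left _ _) (le_max_left _ _),
    ofReal_mem_box hδ (min_le_right _ _) (le_max_right _ _),
    hz _ _ (le_min hb hβ) (min_le_max)⟩⟩

/-- The line `af-transport-constant-width` lands on the crux through the strategist's split. -/
theorem tubeZeroFreeChannel_of_bridge_and_strip (hB : CrossoverBridge) (hS : ConstantWidthStrip) :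
    TubeZeroFreeChannel :=
  tubeZeroFreeChannel_of_split hB (weakCouplingCorridor_of_constantWidthStrip hS)

/-- Elementary but load-bearing for the transport (stated; provable by `norm_integral_le` and
`‖exp(−z s)‖ = exp(−Re z · s)` for real `s`): large-field domination survives complexification
because the Boltzmann factor's modulus only sees `Re z`, whence `‖Z(z; L, t)‖ ≤ Z(Re z; L, t)`. -/
def NormDomination : Prop :=
  ∀ (G : Type) [Group G] [TopologicalSpace G] [IsTopologicalGroup G] [CompactSpace G]
    [MeasurableSpace G] [BorelSpace G] (r : LatticeRep G) (z : ℂ) (a t : ℕ),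
    ‖Zc G r z a t‖ ≤ ‖Zc G r (z.re : ℂ) a t‖

end Summit.QuantumFields.YangMills.Cruxes.TubeZeroFreeChannel.Ideator1
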